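import Literature.NumberTheory.Rogawski1990.CartanRealisation
import Literature.NumberTheory.Automorphic.AdelicUnitaryGroup
import Literature.NumberTheory.Automorphic.UnitaryGroupDirectSum
import HarnessLib

/-!
# Realising a prescribed determinant class by a hermitian form WITH THE SAME SIGNATURES, and the singular-frame reading:
# a global `⋆`-symmetric unit of `Z(γ₀) ≅ M₂(L) × L` with prescribed block classes
# (Landherr 1936; Rogawski 1990 §3.3 Prop. 3.3.1, §3.8 Prop. 3.8.1 (a)(d))

Topic `NumberTheory/QuadraticForms` (§1) and `NumberTheory/Rogawski1990` (§2); **THEOREMS ONLY** (no definition, no named fact, no instance,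
no notation, no `sorry`).  Cell `pub/hodgecm-mathlib`, ENGINE T1 (crux H413 = `stmt-HodgeConjecture-24833`), O7 «singular semisimple classes»,
row (R6a-s)+(P2-s) «singular realisation» (CENSUS-O7 v3 §3; RULING #107 (2); TRUNK WORDS #5 «(B) placewise socket»).

THE MATHEMATICS.  `L` a CM field, `σ` complex conjugation, `L⁺` the maximal real subfield.

* §1 **`exists_hermitian_signature_det_eq_mul`** — for a non-degenerate `σ`-hermitian `H₀ ∈ M_ι(L)` and `ξ ∈ L⁺` TOTALLY POSITIVE
  (`σ ξ = ξ`, `Re τ(ξ) > 0` at every complex embedding `τ`) there is a `σ`-hermitian `Y` with `det Y = ξ · det H₀` ON THE NOSE and the same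
  positive index as `H₀` at every `τ` (diagonalise `H₀ = ᵗ(σG⁻¹) · diag d · G⁻¹`, ★ `Landherr.exists_congr_diagonal`, and rescale ONE diagonal
  entry by `ξ`; Sylvester ★ `Landherr.card_pos_eigenvalues_eq_posCount`).  Companion `exists_hermitian_signature_det_eq_mul_diag` exposes the
  common diagonaliser.  With ★ Landherr `hermitianMatrices_congruent_iff_invariants` this is the REALISATION of the class `ξ · det H₀ · N(Lˣ)`
  in the signature type of `H₀` [Landherr1936; Rogawski1990 §3.3 p. 22 «there is a global element with the given local invariants»].
* §2 **`exists_commute_hermStar_eq_of_frame`** — the SINGULAR-FRAME reading [Rogawski1990 §3.8 Prop. 3.8.1 (a)]: `γ₀ ∈ U(H)(L⁺)` with a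
  frame `P ∈ GL₃(L)`, `ᵗ(σP) H P = H_a ⊕ᶠ H_b`, `γ₀ P = P (a·1₂ ⊕ᶠ b·1₁)` (★ `exists_singular_frame_of_isSemisimpleElt`); for `ξ ∈ L⁺` totally positive
  there are `y ∈ M₃(L)` and hermitian blocks `Y_a, Y_b` with `Commute y γ₀`, `y⋆ = y` (★ `hermStar`), `det y = 1`, `ᵗ(σP) (H·y) P = Y_a ⊕ᶠ Y_b`,
  `det Y_a = ξ · det H_a`, `det Y_b = ξ⁻¹ · det H_b`, and `H·y`, `H` of the same positive index at every `τ` — i.e. the global `y` that the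
  placewise singular `hglob` socket (TRUNK WORDS #5, P5″) asks for, with its block determinant classes `(ξ, ξ⁻¹)` exposed for the local matcher
  (★ (P1-s) `LocalHermitianPlaneCongruence`) and `det y = 1 ∈ N(Lˣ)` for the realisation ★ R6a `exists_unitary_conj_inv_mul_twistGram_eq_of_invariants`.

HONEST LABEL: pure algebra over `L` (no adèles, no unitary-group theory beyond the letters); nothing printed is consumed; HC_CM is proved only modulo
the printed citations until rung 0 closes.

## References
* [Landherr1936HermitianForms] W. Landherr, Abh. Math. Sem. Hamburg 11 (1936) 245–248 (classification and realisation of hermitian forms).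
* [Rogawski1990] J. D. Rogawski, *Automorphic Representations of Unitary Groups in Three Variables*, Ann. of Math. Stud. 123 (1990), §3.3
  Prop. 3.3.1 p. 22, §3.8 Prop. 3.8.1 (a)(d) p. 27.
-/

set_option autoImplicit false

noncomputable section

open NumberField
open scoped Matrix MatrixGroups

/-! ## §1 Realisation of `ξ · det H₀` in the signature type of `H₀` -/

namespace Literature.NumberTheory.QuadraticForms

namespace Landherr

variable (L : Type) [Field L] [NumberField L] [IsCMField L] {ι : Type} [Fintype ι] [DecidableEq ι]

/-- Rescaling ONE entry of a diagonal hermitian form by a totally positive `ξ ∈ L⁺` keeps the positive index at every `τ`. [cite: Landherr1936HermitianForms] -/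
theorem posCount_update_mul_of_pos {ξ : L} (hξ : IsCMField.complexConj L ξ = ξ) (τ : L →+* ℂ) (hξτ : 0 < (τ ξ).re) (d : ι → L) (i₀ : ι) :
    posCount L τ (Function.update d i₀ (ξ * d i₀)) = posCount L τ d := by
  unfold posCount
  refine congrArg Finset.card (Finset.filter_congr fun i _ => ?_)
  by_cases hi : i = i₀
  · subst hi
    rw [Function.update_self, re_mul_of_isReal hξ (d i) τ]
    exact ⟨fun h => pos_of_mul_pos_right h hξτ.le, fun h => mul_pos hξτ h⟩
  · rw [Function.update_of_ne hi]

omit [NumberField L] [IsCMField L] [DecidableEq ι] in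
/-- `∏ (update d i₀ (ξ d_{i₀})) = ξ · ∏ d`. [folklore] -/
private theorem prod_update_mul (ξ : L) (d : ι → L) (i₀ : ι) [DecidableEq ι] :
    ∏ i, Function.update d i₀ (ξ * d i₀) i = ξ * ∏ i, d i := by
  rw [Finset.prod_update_of_mem (Finset.mem_univ i₀), ← Finset.mul_prod_erase Finset.univ d (Finset.mem_univ i₀), mul_assoc]
  congr 1
  rw [Finset.sdiff_singleton_eq_erase]

omit [Fintype ι] in
/-- A diagonal matrix with `σ`-fixed entries is `σ`-hermitian. [folklore] -/
private theorem conjTranspose_diagonal_of_isReal {d : ι → L} (hd : ∀ i, IsCMField.complexConj L (d i) = d i) :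
    conjTranspose L (Matrix.diagonal d) = Matrix.diagonal d := by
  unfold conjTranspose
  rw [Matrix.diagonal_transpose, Matrix.diagonal_map (map_zero _)]
  exact congrArg Matrix.diagonal (funext hd)

/-- **REALISATION WITH A COMMON DIAGONALISER.**  For `H₀` `σ`-hermitian non-degenerate and `ξ ∈ L⁺` totally positive there are a `σ`-hermitian `Y`,
an invertible `G` and diagonal data `d, d′` with `ᵗ(σG) H₀ G = diag d`, `ᵗ(σG) Y G = diag d′`, `det Y = ξ · det H₀`, and `posCount_τ d′ = posCount_τ d`
at every `τ` (so `Y` and `H₀` have the same positive index everywhere): `d′ = d` with one entry rescaled by `ξ`. [cite: Landherr1936HermitianForms]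
[cite: Rogawski1990, §3.3 Prop. 3.3.1 p. 22] -/
theorem exists_hermitian_signature_det_eq_mul_diag [Nonempty ι] {H₀ : Matrix ι ι L} (hH₀ : conjTranspose L H₀ = H₀) (h0 : H₀.det ≠ 0)
    {ξ : L} (hξ : IsCMField.complexConj L ξ = ξ) (hξpos : ∀ τ : L →+* ℂ, 0 < (τ ξ).re) :
    ∃ (Y G : Matrix ι ι L) (d d' : ι → L), conjTranspose L Y = Y ∧ IsUnit G.det ∧
      (∀ i, IsCMField.complexConj L (d i) = d i) ∧ (∀ i, IsCMField.complexConj L (d' i) = d' i) ∧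
      conjTranspose L G * H₀ * G = Matrix.diagonal d ∧ conjTranspose L G * Y * G = Matrix.diagonal d' ∧
      Y.det = ξ * H₀.det ∧ ∀ τ : L →+* ℂ, posCount L τ d' = posCount L τ d := by
  obtain ⟨G, hG, d, hd, hd0, e⟩ := exists_congr_diagonal L H₀ hH₀ h0
  obtain ⟨i₀⟩ := ‹Nonempty ι›
  set d' : ι → L := Function.update d i₀ (ξ * d i₀) with hd'
  have hd'σ : ∀ i, IsCMField.complexConj L (d' i) = d' i := by
    intro i
    by_cases hi : i = i₀
    · subst hi; rw [hd', Function.update_self, map_mul, hξ, hd]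
    · rw [hd', Function.update_of_ne hi, hd]
  -- `Y := ᵗ(σG⁻¹) · diag d′ · G⁻¹`
  set Y : Matrix ι ι L := conjTranspose L G⁻¹ * Matrix.diagonal d' * G⁻¹ with hY
  have hGinv : G⁻¹ * G = 1 := Matrix.nonsing_inv_mul G hG
  have e' : conjTranspose L G * Y * G = Matrix.diagonal d' := by
    rw [hY]
    calc conjTranspose L G * (conjTranspose L G⁻¹ * Matrix.diagonal d' * G⁻¹) * G
        = conjTranspose L (G⁻¹ * G) * Matrix.diagonal d' * (G⁻¹ * G) := by
          rw [conjTranspose_mul]; simp only [Matrix.mul_assoc]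
      _ = Matrix.diagonal d' := by rw [hGinv, conjTranspose_one, Matrix.one_mul, Matrix.mul_one]
  have hYh : conjTranspose L Y = Y := by
    rw [hY, conjTranspose_mul, conjTranspose_mul, conjTranspose_conjTranspose, conjTranspose_diagonal_of_isReal L hd'σ, Matrix.mul_assoc]
  refine ⟨Y, G, d, d', hYh, hG, hd, hd'σ, e, e', ?_, fun τ => posCount_update_mul_of_pos L hξ τ (hξpos τ) d i₀⟩
  -- determinants: `∏ d′ = det Y · N(det G)`, `∏ d = det H₀ · N(det G)`, `∏ d′ = ξ ∏ d`
  have h1 := prod_eq_det_mul_norm L e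
  have h2 := prod_eq_det_mul_norm L e'
  have h3 : ∏ i, d' i = ξ * ∏ i, d i := prod_update_mul L ξ d i₀
  have hN : G.det * IsCMField.complexConj L G.det ≠ 0 :=
    mul_ne_zero hG.ne_zero ((map_ne_zero _).2 hG.ne_zero)
  rw [h1, h2] at h3
  exact mul_right_cancel₀ hN (by rw [h3, mul_assoc])

/-- **REALISATION OF A DETERMINANT CLASS IN A GIVEN SIGNATURE TYPE.**  For `H₀ ∈ M_ι(L)` `σ`-hermitian non-degenerate (`ι` non-empty) and
`ξ ∈ L⁺` totally positive there is a `σ`-hermitian `Y` with `det Y = ξ · det H₀` and, at every complex embedding `τ`, the same number of positive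
eigenvalues as `H₀` (so positive definite where `H₀` is).  By ★ `hermitianMatrices_congruent_iff_invariants` any `σ`-hermitian form with the
signatures of `H₀` and `det ∈ ξ · det H₀ · N(Lˣ)` is congruent over `L` to this `Y`. [cite: Landherr1936HermitianForms] [cite: Rogawski1990, §3.3 Prop. 3.3.1 p. 22] -/
theorem exists_hermitian_signature_det_eq_mul [Nonempty ι] {H₀ : Matrix ι ι L} (hH₀ : conjTranspose L H₀ = H₀) (h0 : H₀.det ≠ 0)
    {ξ : L} (hξ : IsCMField.complexConj L ξ = ξ) (hξpos : ∀ τ : L →+* ℂ, 0 < (τ ξ).re) :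
    ∃ Y : Matrix ι ι L, conjTranspose L Y = Y ∧ Y.det = ξ * H₀.det ∧
      ∀ (τ : L →+* ℂ) (h₁ : (H₀.map τ).IsHermitian) (h₂ : (Y.map τ).IsHermitian),
        (Finset.univ.filter fun i => 0 < h₁.eigenvalues i).card = (Finset.univ.filter fun i => 0 < h₂.eigenvalues i).card := by
  obtain ⟨Y, G, d, d', hYh, hG, -, -, e, e', hdet, hpos⟩ := exists_hermitian_signature_det_eq_mul_diag L hH₀ h0 hξ hξpos
  refine ⟨Y, hYh, hdet, fun τ h₁ h₂ => ?_⟩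
  rw [card_pos_eigenvalues_eq_posCount L hH₀ hG e τ, card_pos_eigenvalues_eq_posCount L hYh hG e' τ, hpos]

end Landherr

end Literature.NumberTheory.QuadraticForms

/-! ## §2 The singular-frame reading: a global `⋆`-symmetric unit of `Z(γ₀) ≅ M₂(L) × L` with prescribed block classes -/

namespace Literature.NumberTheory.Rogawski1990

open Literature.NumberTheory.QuadraticForms
open Literature.NumberTheory.Automorphic
open Literature.NumberTheory.Automorphic.UnitaryGroup (finSum finSum_map)

/-! ### §2.0 Block algebra over `⊕ᶠ` (private copies of the tree's `finSum` plumbing) -/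

section Blocks

variable {S : Type*} [CommRing S] {N₁ N₂ : ℕ}

/-- `(A ⊕ᶠ B)(C ⊕ᶠ D) = AC ⊕ᶠ BD`. [folklore] -/
private theorem finSum_mul_finSum'' (A C : Matrix (Fin N₁) (Fin N₁) S) (B D : Matrix (Fin N₂) (Fin N₂) S) :
    finSum N₁ N₂ A B * finSum N₁ N₂ C D = finSum N₁ N₂ (A * C) (B * D) := by
  simp only [finSum, Matrix.reindex_apply, Matrix.submatrix_mul_equiv, Matrix.fromBlocks_multiply, Matrix.mul_zero, Matrix.zero_mul,
    add_zero, zero_add]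

/-- `ᵗ(σ(A ⊕ᶠ B)) = ᵗ(σA) ⊕ᶠ ᵗ(σB)`. [folklore] -/
private theorem finSum_conjTranspose'' (σ : S →+* S) (A : Matrix (Fin N₁) (Fin N₁) S) (B : Matrix (Fin N₂) (Fin N₂) S) :
    ((finSum N₁ N₂ A B).map σ)ᵀ = finSum N₁ N₂ ((A.map σ)ᵀ) ((B.map σ)ᵀ) := by
  rw [finSum_map]
  simp only [finSum, Matrix.reindex_apply, Matrix.transpose_submatrix, Matrix.fromBlocks_transpose, Matrix.transpose_zero]

/-- `det (A ⊕ᶠ B) = det A · det B`. [folklore] -/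
private theorem det_finSum'' (A : Matrix (Fin N₁) (Fin N₁) S) (B : Matrix (Fin N₂) (Fin N₂) S) : (finSum N₁ N₂ A B).det = A.det * B.det := by
  rw [finSum, Matrix.det_reindex_self, Matrix.det_fromBlocks_zero₂₁]

/-- Block scalars commute with block-diagonal matrices: `(A ⊕ᶠ B)(a·1 ⊕ᶠ b·1) = (a·1 ⊕ᶠ b·1)(A ⊕ᶠ B)`. [folklore] -/
private theorem finSum_mul_finSum_smul_one_comm (A : Matrix (Fin N₁) (Fin N₁) S) (B : Matrix (Fin N₂) (Fin N₂) S) (a b : S) :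
    finSum N₁ N₂ A B * finSum N₁ N₂ (a • (1 : Matrix (Fin N₁) (Fin N₁) S)) (b • (1 : Matrix (Fin N₂) (Fin N₂) S)) =
      finSum N₁ N₂ (a • (1 : Matrix (Fin N₁) (Fin N₁) S)) (b • (1 : Matrix (Fin N₂) (Fin N₂) S)) * finSum N₁ N₂ A B := by
  rw [finSum_mul_finSum'', finSum_mul_finSum'', Matrix.mul_smul, Matrix.mul_one, Matrix.mul_smul, Matrix.mul_one, Matrix.smul_mul,
    Matrix.one_mul, Matrix.smul_mul, Matrix.one_mul]

/-- `diag d₁ ⊕ᶠ diag d₂ = diag (d₁ ⊔ d₂ ∘ e⁻¹)` in the concatenated `Fin` basis. [folklore] -/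
private theorem finSum_diagonal (d₁ : Fin N₁ → S) (d₂ : Fin N₂ → S) :
    finSum N₁ N₂ (Matrix.diagonal d₁) (Matrix.diagonal d₂) = Matrix.diagonal (Sum.elim d₁ d₂ ∘ finSumFinEquiv.symm) := by
  rw [finSum, Matrix.fromBlocks_diagonal, Matrix.reindex_apply, Matrix.submatrix_diagonal_equiv]

end Blocks

/-! ### §2.1 Letters: the two conjugate-transpose spellings, `⋆`-symmetry from hermitian `H · y`, a totally positive rescaling -/

section Letters

variable {L : Type} [Field L] [NumberField L] [IsCMField L]

/-- `σ² = 1` on `L`. [folklore] -/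
private theorem cmConjRingHom_cmConjRingHom (x : L) : cmConjRingHom L (cmConjRingHom L x) = x :=
  IsCMField.complexConj_apply_apply _ _

/-- `ᵗσ(ᵗσ M) = M`. [folklore] -/
private theorem conjTranspose_conjTranspose' {ι κ : Type} (M : Matrix ι κ L) :
    (((M.map (cmConjRingHom L))ᵀ).map (cmConjRingHom L))ᵀ = M := by
  ext i j
  simp only [Matrix.transpose_apply, Matrix.map_apply, cmConjRingHom_cmConjRingHom]

/-- **`⋆`-symmetry from hermitian `H · y`**: if `H` is hermitian invertible and `H · y` is hermitian then `y⋆ = y` (`y⋆ := H⁻¹ ᵗ(σy) H`).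
[cite: Rogawski1990, §3.5 p. 29] -/
theorem hermStar_eq_self_of_mul_hermitian {n : Type} [Fintype n] [DecidableEq n] {H : Matrix n n L} (hH : (H.map (cmConjRingHom L))ᵀ = H)
    (h0 : IsUnit H.det) {y : Matrix n n L} (hy : ((H * y).map (cmConjRingHom L))ᵀ = H * y) : hermStar (cmConjRingHom L) H y = y := by
  rw [hermStar_def, Matrix.mul_assoc]
  have h : (y.map (cmConjRingHom L))ᵀ * H = H * y := by
    rw [Matrix.map_mul, Matrix.transpose_mul, hH] at hy
    exact hy
  rw [h, ← Matrix.mul_assoc, Matrix.nonsing_inv_mul H h0, Matrix.one_mul]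

/-- A congruence by an invertible `Q` reflects hermitian-ness: `ᵗ(σQ) M Q` hermitian ⇒ `M` hermitian. [cite: Landherr1936HermitianForms] -/
theorem hermitian_of_congr_hermitian {n : Type} [Fintype n] [DecidableEq n] (Q : GL n L) {M : Matrix n n L}
    (h : ((((Q : Matrix n n L).map (cmConjRingHom L))ᵀ * M * (Q : Matrix n n L)).map (cmConjRingHom L))ᵀ =
      ((Q : Matrix n n L).map (cmConjRingHom L))ᵀ * M * (Q : Matrix n n L)) :
    (M.map (cmConjRingHom L))ᵀ = M := by
  set Qs : Matrix n n L := ((Q : Matrix n n L).map (cmConjRingHom L))ᵀ with hQs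
  have hlhs : ((Qs * M * (Q : Matrix n n L)).map (cmConjRingHom L))ᵀ = Qs * (M.map (cmConjRingHom L))ᵀ * (Q : Matrix n n L) := by
    rw [Matrix.map_mul, Matrix.map_mul, Matrix.transpose_mul, Matrix.transpose_mul, hQs, conjTranspose_conjTranspose', Matrix.mul_assoc]
  rw [hlhs] at h
  -- cancel `Qs` (invertible: `det Qs = σ(det Q)`) on the left and `Q` on the right
  have hQsu : IsUnit Qs.det := by
    rw [hQs, Matrix.det_transpose, ← RingHom.mapMatrix_apply, ← RingHom.map_det]
    exact (Matrix.isUnits_det_units Q).map _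
  have hQu : IsUnit (Q : Matrix n n L).det := Matrix.isUnits_det_units Q
  have h' := congrArg (fun X => Qs⁻¹ * X * (Q : Matrix n n L)⁻¹) h
  simp only [← Matrix.mul_assoc, Matrix.nonsing_inv_mul _ hQsu, Matrix.one_mul] at h'
  simp only [Matrix.mul_assoc, Matrix.mul_nonsing_inv _ hQu, Matrix.mul_one] at h'
  exact h'

/-- A totally positive `σ`-fixed rescaling of a diagonal keeps the positive index (private copy of ★ `Landherr.posCount_mul_of_pos`). [folklore] -/
private theorem posCount_smul_of_pos {ι : Type} [Fintype ι] {c : L} (hc : IsCMField.complexConj L c = c) (τ : L →+* ℂ) (hcτ : 0 < (τ c).re)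
    (d : ι → L) : Landherr.posCount L τ (c • d) = Landherr.posCount L τ d := by
  unfold Landherr.posCount
  exact congrArg Finset.card (Finset.filter_congr fun i _ => by
    rw [Pi.smul_apply, smul_eq_mul, Landherr.re_mul_of_isReal hc (d i) τ]
    exact ⟨fun h => pos_of_mul_pos_right h hcτ.le, fun h => mul_pos hcτ h⟩)

end Letters

/-! ### §2.2 The frame reading -/

section Frame

variable {L : Type} [Field L] [NumberField L] [IsCMField L]

/-- **A GLOBAL `⋆`-SYMMETRIC UNIT OF `Z(γ₀)` WITH PRESCRIBED BLOCK CLASSES (singular frame).**  Let `H ∈ M₃(L)` be hermitian non-degenerate over the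
CM field `L`, `γ₀ ∈ M₃(L)` with a frame `P ∈ GL₃(L)`: `ᵗ(σP) H P = H_a ⊕ᶠ H_b` (`H_a ∈ M₂`, `H_b ∈ M₁` hermitian non-degenerate) and
`γ₀ P = P (a·1₂ ⊕ᶠ b·1₁)` (★ `exists_singular_frame_of_isSemisimpleElt`, [Prop. 3.8.1 (a)]).  For every `ξ ∈ L⁺` TOTALLY POSITIVE there are
`y ∈ M₃(L)` and hermitian `Y_a ∈ M₂(L)`, `Y_b ∈ M₁(L)` with: `y = P (H_a⁻¹Y_a ⊕ᶠ H_b⁻¹Y_b) P⁻¹`; `y γ₀ = γ₀ y`; `y⋆ = y`; `det y = 1`; `ᵗ(σP) (H·y) P = Y_a ⊕ᶠ Y_b`;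
`det Y_a = ξ · det H_a`, `det Y_b = ξ⁻¹ · det H_b`; and `H·y`, `H` have the same positive index at every complex embedding — the global
representative, with block determinant classes `(ξ, ξ⁻¹)` mod `N(Lˣ)`, of the `Z(γ₀)`-class that Kottwitz's criterion at a SINGULAR semisimple
`γ₀` compares the adelic class `x_g` with, place by place [Prop. 3.3.1; Prop. 3.8.1 (d): `|𝓡| = 2`]. [cite: Rogawski1990, §3.3 Prop. 3.3.1 p. 22; §3.8 Prop. 3.8.1 (a)(d) p. 27]
[cite: Landherr1936HermitianForms] -/
theorem exists_commute_hermStar_eq_of_frame {H : Matrix (Fin 3) (Fin 3) L} (hH : (H.map (cmConjRingHom L))ᵀ = H) (h0 : H.det ≠ 0)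
    (γ₀ : Matrix (Fin 3) (Fin 3) L) {a b : L} {P : GL (Fin 3) L} {Ha : Matrix (Fin 2) (Fin 2) L} {Hb : Matrix (Fin 1) (Fin 1) L}
    (hP : (((P : Matrix (Fin 3) (Fin 3) L)).map (cmConjRingHom L))ᵀ * H * (P : Matrix (Fin 3) (Fin 3) L) = finSum 2 1 Ha Hb)
    (hγP : γ₀ * (P : Matrix (Fin 3) (Fin 3) L) =
      (P : Matrix (Fin 3) (Fin 3) L) * finSum 2 1 (a • (1 : Matrix (Fin 2) (Fin 2) L)) (b • (1 : Matrix (Fin 1) (Fin 1) L)))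
    (hHa : (Ha.map (cmConjRingHom L))ᵀ = Ha) (hHb : (Hb.map (cmConjRingHom L))ᵀ = Hb) (hda : Ha.det ≠ 0) (hdb : Hb.det ≠ 0)
    {ξ : L} (hξ : cmConjRingHom L ξ = ξ) (hξpos : ∀ τ : L →+* ℂ, 0 < (τ ξ).re) :
    ∃ (y : Matrix (Fin 3) (Fin 3) L) (Ya : Matrix (Fin 2) (Fin 2) L) (Yb : Matrix (Fin 1) (Fin 1) L),
      y = (P : Matrix (Fin 3) (Fin 3) L) * finSum 2 1 (Ha⁻¹ * Ya) (Hb⁻¹ * Yb) * ((P⁻¹ : GL (Fin 3) L) : Matrix (Fin 3) (Fin 3) L) ∧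
      Commute y γ₀ ∧ hermStar (cmConjRingHom L) H y = y ∧ y.det = 1 ∧
      (Ya.map (cmConjRingHom L))ᵀ = Ya ∧ (Yb.map (cmConjRingHom L))ᵀ = Yb ∧ Ya.det = ξ * Ha.det ∧ Yb.det = ξ⁻¹ * Hb.det ∧
      (((P : Matrix (Fin 3) (Fin 3) L)).map (cmConjRingHom L))ᵀ * (H * y) * (P : Matrix (Fin 3) (Fin 3) L) = finSum 2 1 Ya Yb ∧
      ∀ (ρ : L →+* ℂ) (h₁ : (H.map ρ).IsHermitian) (h₂ : ((H * y).map ρ).IsHermitian),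
        (Finset.univ.filter fun i => 0 < h₁.eigenvalues i).card = (Finset.univ.filter fun i => 0 < h₂.eigenvalues i).card := by
  have hξ' : IsCMField.complexConj L ξ = ξ := hξ
  have hξ0 : ξ ≠ 0 := by
    obtain ⟨τ₀⟩ : Nonempty (L →+* ℂ) := inferInstance
    intro h; have := hξpos τ₀; rw [h, map_zero, Complex.zero_re] at this; exact lt_irrefl _ this
  have hξi : IsCMField.complexConj L ξ⁻¹ = ξ⁻¹ := by rw [map_inv₀, hξ']
  have hξipos : ∀ τ : L →+* ℂ, 0 < (τ ξ⁻¹).re := fun τ => by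
    rw [Landherr.re_inv_of_isReal hξ' τ]; exact inv_pos.2 (hξpos τ)
  -- §1 on the rank-2 block, a rescaling on the rank-1 block
  obtain ⟨Ya, Ga, da, da', hYa, hGa, hdaσ, hda'σ, ea, ea', hdetYa, hposa⟩ :=
    Landherr.exists_hermitian_signature_det_eq_mul_diag L (H₀ := Ha) hHa hda hξ' hξpos
  obtain ⟨Gb, hGb, db, hdbσ, -, eb⟩ := Landherr.exists_congr_diagonal L Hb hHb hdb
  set Yb : Matrix (Fin 1) (Fin 1) L := ξ⁻¹ • Hb with hYb_def
  have hYb : (Yb.map (cmConjRingHom L))ᵀ = Yb := by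
    rw [hYb_def, Matrix.map_smul' _ _ _ (map_mul (cmConjRingHom L)), Matrix.transpose_smul, hHb]
    exact congrArg (· • Hb) hξi
  have eb' : Landherr.conjTranspose L Gb * Yb * Gb = Matrix.diagonal (ξ⁻¹ • db) := by
    rw [hYb_def, Matrix.mul_smul, Matrix.smul_mul, eb, Matrix.diagonal_smul]
  have hdetYb : Yb.det = ξ⁻¹ * Hb.det := by
    rw [hYb_def, Matrix.det_smul, Fintype.card_fin, pow_one]
  -- the blocks of `y` in the frame
  set Q : Matrix (Fin 3) (Fin 3) L := (P : Matrix (Fin 3) (Fin 3) L) with hQ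
  set Qs : Matrix (Fin 3) (Fin 3) L := (Q.map (cmConjRingHom L))ᵀ with hQs
  set S : Matrix (Fin 3) (Fin 3) L := finSum 2 1 Ha Hb with hS
  set T : Matrix (Fin 3) (Fin 3) L := finSum 2 1 Ya Yb with hT
  set M : Matrix (Fin 3) (Fin 3) L := finSum 2 1 (Ha⁻¹ * Ya) (Hb⁻¹ * Yb) with hM
  set y : Matrix (Fin 3) (Fin 3) L := Q * M * ((P⁻¹ : GL (Fin 3) L) : Matrix (Fin 3) (Fin 3) L) with hy
  have hPP : Q * ((P⁻¹ : GL (Fin 3) L) : Matrix (Fin 3) (Fin 3) L) = 1 := P.mul_inv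
  have hPP' : ((P⁻¹ : GL (Fin 3) L) : Matrix (Fin 3) (Fin 3) L) * Q = 1 := P.inv_mul
  have hSM : S * M = T := by
    rw [hS, hM, hT, finSum_mul_finSum'', ← Matrix.mul_assoc, ← Matrix.mul_assoc, Matrix.mul_nonsing_inv Ha (Ne.isUnit hda),
      Matrix.mul_nonsing_inv Hb (Ne.isUnit hdb), Matrix.one_mul, Matrix.one_mul]
  -- the frame identity for `H · y`
  have hframe : Qs * (H * y) * Q = T := by
    have h1 : Qs * (H * y) * Q = Qs * H * Q * M * (((P⁻¹ : GL (Fin 3) L) : Matrix (Fin 3) (Fin 3) L) * Q) := by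
      rw [hy]; simp only [Matrix.mul_assoc]
    rw [h1, hPP', Matrix.mul_one, hP, hSM]
  have hYa' : (Ya.map (cmConjRingHom L))ᵀ = Ya := hYa
  have hT_herm : (T.map (cmConjRingHom L))ᵀ = T := by
    rw [hT, finSum_conjTranspose'', hYa', hYb]
  -- `H · y` is hermitian (its frame congruent `T` is), hence `y⋆ = y`
  have hHy_herm : ((H * y).map (cmConjRingHom L))ᵀ = H * y := by
    refine hermitian_of_congr_hermitian P ?_
    rw [← hQ, ← hQs, hframe, hT_herm]
  have hstar : hermStar (cmConjRingHom L) H y = y := hermStar_eq_self_of_mul_hermitian hH (Ne.isUnit h0) hHy_herm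
  -- `y` commutes with `γ₀ = P (a·1 ⊕ᶠ b·1) P⁻¹`
  have hγ : γ₀ = Q * finSum 2 1 (a • (1 : Matrix (Fin 2) (Fin 2) L)) (b • (1 : Matrix (Fin 1) (Fin 1) L)) *
      ((P⁻¹ : GL (Fin 3) L) : Matrix (Fin 3) (Fin 3) L) := by
    rw [← hγP, Matrix.mul_assoc, hPP, Matrix.mul_one]
  have hcomm : Commute y γ₀ := by
    rw [Commute, SemiconjBy, hγ, hy]
    calc Q * M * ((P⁻¹ : GL (Fin 3) L) : Matrix (Fin 3) (Fin 3) L) *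
          (Q * finSum 2 1 (a • (1 : Matrix (Fin 2) (Fin 2) L)) (b • (1 : Matrix (Fin 1) (Fin 1) L)) * ((P⁻¹ : GL (Fin 3) L) : Matrix (Fin 3) (Fin 3) L))
        = Q * (M * ((((P⁻¹ : GL (Fin 3) L) : Matrix (Fin 3) (Fin 3) L) * Q) *
            finSum 2 1 (a • (1 : Matrix (Fin 2) (Fin 2) L)) (b • (1 : Matrix (Fin 1) (Fin 1) L)))) * ((P⁻¹ : GL (Fin 3) L) : Matrix (Fin 3) (Fin 3) L) := by
          simp only [Matrix.mul_assoc]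
      _ = Q * (finSum 2 1 (a • (1 : Matrix (Fin 2) (Fin 2) L)) (b • (1 : Matrix (Fin 1) (Fin 1) L)) *
            ((((P⁻¹ : GL (Fin 3) L) : Matrix (Fin 3) (Fin 3) L) * Q) * M)) * ((P⁻¹ : GL (Fin 3) L) : Matrix (Fin 3) (Fin 3) L) := by
          rw [hPP', Matrix.one_mul, Matrix.one_mul, hM, finSum_mul_finSum_smul_one_comm]
      _ = Q * finSum 2 1 (a • (1 : Matrix (Fin 2) (Fin 2) L)) (b • (1 : Matrix (Fin 1) (Fin 1) L)) * ((P⁻¹ : GL (Fin 3) L) : Matrix (Fin 3) (Fin 3) L) *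
            (Q * M * ((P⁻¹ : GL (Fin 3) L) : Matrix (Fin 3) (Fin 3) L)) := by
          simp only [Matrix.mul_assoc]
  -- `det y = 1`
  have hdet : y.det = 1 := by
    have hM1 : M.det = 1 := by
      rw [hM, det_finSum'', Matrix.det_mul, Matrix.det_mul, Matrix.det_nonsing_inv, Matrix.det_nonsing_inv,
        Ring.inverse_eq_inv Ha.det, Ring.inverse_eq_inv Hb.det, hdetYa, hdetYb]
      field_simp
    rw [hy, hQ, Matrix.det_units_conj, hM1]
  -- signatures: the common diagonaliser `G₃ := P · (G_a ⊕ᶠ G_b)` of `H` and `H · y`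
  set G₃ : Matrix (Fin 3) (Fin 3) L := Q * finSum 2 1 Ga Gb with hG₃_def
  have hG₃ : IsUnit G₃.det := by
    rw [hG₃_def, Matrix.det_mul, det_finSum'']
    exact (Matrix.isUnits_det_units P).mul (hGa.mul hGb)
  have hG₃s : Landherr.conjTranspose L G₃ = finSum 2 1 (Landherr.conjTranspose L Ga) (Landherr.conjTranspose L Gb) * Qs := by
    rw [hG₃_def, Landherr.conjTranspose_mul, landherr_conjTranspose_eq L (finSum 2 1 Ga Gb), finSum_conjTranspose'', hQs]
    rfl
  have e₃ : Landherr.conjTranspose L G₃ * H * G₃ = Matrix.diagonal (Sum.elim da db ∘ finSumFinEquiv.symm) := by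
    rw [hG₃s, hG₃_def]
    calc finSum 2 1 (Landherr.conjTranspose L Ga) (Landherr.conjTranspose L Gb) * Qs * H * (Q * finSum 2 1 Ga Gb)
        = finSum 2 1 (Landherr.conjTranspose L Ga) (Landherr.conjTranspose L Gb) * (Qs * H * Q) * finSum 2 1 Ga Gb := by
          simp only [Matrix.mul_assoc]
      _ = Matrix.diagonal (Sum.elim da db ∘ finSumFinEquiv.symm) := by
          rw [hP, hS, finSum_mul_finSum'', finSum_mul_finSum'', ea, eb, finSum_diagonal]
  have e₃' : Landherr.conjTranspose L G₃ * (H * y) * G₃ = Matrix.diagonal (Sum.elim da' (ξ⁻¹ • db) ∘ finSumFinEquiv.symm) := by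
    rw [hG₃s, hG₃_def]
    calc finSum 2 1 (Landherr.conjTranspose L Ga) (Landherr.conjTranspose L Gb) * Qs * (H * y) * (Q * finSum 2 1 Ga Gb)
        = finSum 2 1 (Landherr.conjTranspose L Ga) (Landherr.conjTranspose L Gb) * (Qs * (H * y) * Q) * finSum 2 1 Ga Gb := by
          simp only [Matrix.mul_assoc]
      _ = Matrix.diagonal (Sum.elim da' (ξ⁻¹ • db) ∘ finSumFinEquiv.symm) := by
          rw [hframe, hT, finSum_mul_finSum'', finSum_mul_finSum'', ea', eb', finSum_diagonal]
  have hHl : Landherr.conjTranspose L H = H := hH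
  have hHyl : Landherr.conjTranspose L (H * y) = H * y := hHy_herm
  refine ⟨y, Ya, Yb, hy, hcomm, hstar, hdet, hYa', hYb, hdetYa, hdetYb, ?_, fun ρ h₁ h₂ => ?_⟩
  · exact hframe
  · rw [Landherr.card_pos_eigenvalues_eq_posCount L hHl hG₃ e₃ ρ, Landherr.card_pos_eigenvalues_eq_posCount L hHyl hG₃ e₃' ρ,
      Landherr.posCount_comp_equiv, Landherr.posCount_comp_equiv, Landherr.posCount_sum_elim, Landherr.posCount_sum_elim, hposa ρ,
      posCount_smul_of_pos hξi ρ (hξipos ρ)]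

end Frame

end Literature.NumberTheory.Rogawski1990

end
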